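/-
Copyright (c) 2026 the pub-hodgecm-mathlib formalisation cell (harness21).  Prover seat hodgecm-mathlib-R90-C10-p03 (g0) (valve hand to L1),
Track B «K2-LIT» ∕ hLiu418 #184♮ = `stmt-HodgeConjecture-24832`, socket #41 K1-b♮ ∕ (P-dec) organ — K2Liu-p14 (g4) K1b∕ρ DESK WORD #4 brick (ρ6a)(i)
«the NORMALISED row section `γ : ℙ(K²) → GL₂(K)`» (LEAD F0P6-plan (g14) BATCH #159 (1)).
-/
import Summits.HodgeConjecture.HodgeConjecture.Theorems.K2LiuSiegelMiddleCellLeviCriterion   -- ★ `row_ne_zero` (the binder shape of ★ p861327's `hγ`)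
import HarnessLib

/-!
# K2_Liu road (hLiu418), (P-dec) organ, brick (ρ6a)(i): THE NORMALISED ROW SECTION `γ : ℙ(K²) → GL₂(K)` — `γ[w] = (e_{1−i(w)} ; w / w_{i(w)})`, its entries
# and its inverse's entries lie in `{0, 1, ± w_k / w_{i(w)}}`

Cell `pub/hodgecm-mathlib` (D-0151), Track B.  Lane `--kind proof --supports stmt-HodgeConjecture-24832 --as helper` (count-neutral; THEOREMS ONLY: no `def`,
no `instance`, no notation, no named-fact hypothesis, no `sorry`; the section is delivered as an `∃`-head, so consumers keep taking `(γ, hγ)` as binders).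

WHY (K2Liu-p14 (g4) WORD #4, bricks (ρ6a)/(ρ6b) of the (P-dec) decay organ `K2LiuKindOneLineDecay`): the middle-cell ∕ rank-one line sums of socket #41 run over
`p ∈ ℙ(L²)` through a section `γ : ℙ(L²) → GL₂(L)` with `[row₁ (γ p)] = p` (★ p861327's binder
`hγ : ∀ p, Projectivization.mk L ((γ p : Matrix (Fin 2) (Fin 2) L) 1) (row_ne_zero (γ p) 1) = p`), and the polynomial prefactors of the decay see `γ p` only
through the HEIGHT of `Λ(γ p)`; to control it by the projective height `Height.mulHeight w` of `p = [w]` ((ρ6b) ★∕📤 `K2LiuRankOneLineProjectiveHeight`, F0P2-p09)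
one needs a section whose entries are controlled by `w`: the NORMALISED section `γ[w] := (e_{1−i} ; w / w_i)`, `i = i(w)` the first non-zero coordinate
(`i = 0` if `w₀ ≠ 0`: `γ = (0 1; 1 w₁/w₀)`, `γ⁻¹ = (−w₁/w₀ 1; 1 0)`; `i = 1` if `w₀ = 0`: `γ = γ⁻¹ = 1`).  This file constructs it:
* §1 the two explicit `GL₂` matrices `(0 1; 1 t)` ∕ `1` with their inverses (`gammaT t`-type lemmas as plain theorems about `!![…]`);
* §2 **`exists_normalised_rowSection`** — `∃ γ : ℙ K (Fin 2 → K) → GL (Fin 2) K` with (a) ★ p861327's `hγ` VERBATIM, and (b) for EVERY representative `w ≠ 0`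
  of `p`: an index `i` with `w i ≠ 0`, `row₁ (γ p) = (w i)⁻¹ • w`, and every entry of `γ p` and of `(γ p)⁻¹` is `0`, `1`, `(w i)⁻¹ * w k` or `-((w i)⁻¹ * w k)`
  for some `k` — so at every place `|entry|_v ≤ max(1, max_k |w_k|_v / |w_i|_v)`, the shape (ρ6a)(ii) ∕ (B-ii) consume.  Generic over a field `K`.
HONEST LABEL: HC_CM is proved only modulo the 7 printed citations (2 remaining named inputs: hLiu418 = `stmt-HodgeConjecture-24832`, h413 =
`stmt-HodgeConjecture-24833`) until rung 0 closes; this helper closes nothing and moves no counter.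
References: [BorelJacquet1979] §1.2 (heights of rational points); [MoeglinWaldspurger1995] II.1.7 (constant terms along `P\G` over rational points);
[GelbartRogawski1991] §3.1 Prop. 3.1.1 p. 455.
-/

set_option autoImplicit false
set_option linter.dupNamespace false -- the mandated namespace repeats `HodgeConjecture.HodgeConjecture`

noncomputable section

open scoped Matrix

namespace Summit.HodgeConjecture.HodgeConjecture.Cruxes.HLiu418.K2LiuRankOneRowSection

open Summit.HodgeConjecture.HodgeConjecture.Cruxes.HLiu418.K2LiuSiegelMiddleCellLeviCriterion (row_ne_zero)

variable {K : Type*} [Field K]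

/-! ## §1 The two explicit matrices -/

/-- `(0 1; 1 t) · (−t 1; 1 0) = 1`. [folklore] -/
theorem swapT_mul_inv (t : K) : !![(0 : K), 1; 1, t] * !![-t, 1; 1, 0] = 1 := by
  ext i j
  fin_cases i <;> fin_cases j <;> simp [Matrix.mul_apply, Fin.sum_univ_two]

/-- `(−t 1; 1 0) · (0 1; 1 t) = 1`. [folklore] -/
theorem inv_mul_swapT (t : K) : !![-t, 1; 1, (0 : K)] * !![0, 1; 1, t] = 1 := by
  ext i j
  fin_cases i <;> fin_cases j <;> simp [Matrix.mul_apply, Fin.sum_univ_two]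

/-- every entry of `(0 1; 1 t)` is `0`, `1` or `t`. [folklore] -/
theorem swapT_apply_mem (t : K) (a b : Fin 2) : !![(0 : K), 1; 1, t] a b = 0 ∨ !![(0 : K), 1; 1, t] a b = 1 ∨ !![(0 : K), 1; 1, t] a b = t := by
  fin_cases a <;> fin_cases b <;> simp

/-- every entry of `(−t 1; 1 0)` is `0`, `1` or `−t`. [folklore] -/
theorem swapTinv_apply_mem (t : K) (a b : Fin 2) : !![-t, 1; 1, (0 : K)] a b = 0 ∨ !![-t, 1; 1, (0 : K)] a b = 1 ∨ !![-t, 1; 1, (0 : K)] a b = -t := by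
  fin_cases a <;> fin_cases b <;> simp

/-! ## §2 The normalised row section -/

/-- **THE NORMALISED ROW SECTION `γ : ℙ(K²) → GL₂(K)`.**  There is a section `γ` of `g ↦ [row₁ g]` (★ p861327's binder `hγ` verbatim:
`Projectivization.mk K ((γ p) 1) (row_ne_zero (γ p) 1) = p`) which is NORMALISED: for every representative `w ≠ 0` of `p` there is an index `i` with
`w i ≠ 0`, the second row of `γ p` is `w / w_i`, and every entry of `γ p` and of `(γ p)⁻¹` is one of `0`, `1`, `w_k / w_i`, `−(w_k / w_i)` (`k : Fin 2`).
Construction: `i :=` the first non-zero coordinate of `p.rep`; `γ p := (0 1; 1 w₁/w₀)` if `w₀ ≠ 0` (inverse `(−w₁/w₀ 1; 1 0)`), `γ p := 1` if `w₀ = 0`;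
the normalised row `w / w_i` does not depend on the representative. [cite: BorelJacquet1979, §1.2] [cite: MoeglinWaldspurger1995, II.1.7] -/
theorem exists_normalised_rowSection :
    ∃ γ : Projectivization K (Fin 2 → K) → GL (Fin 2) K,
      (∀ p, Projectivization.mk K ((γ p : Matrix (Fin 2) (Fin 2) K) 1) (row_ne_zero (γ p) 1) = p) ∧
      ∀ (w : Fin 2 → K) (hw : w ≠ 0), ∃ i : Fin 2, w i ≠ 0 ∧
        (γ (Projectivization.mk K w hw) : Matrix (Fin 2) (Fin 2) K) 1 = (w i)⁻¹ • w ∧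
        ∀ a b : Fin 2,
          (∃ k : Fin 2, (γ (Projectivization.mk K w hw) : Matrix (Fin 2) (Fin 2) K) a b = 0 ∨
            (γ (Projectivization.mk K w hw) : Matrix (Fin 2) (Fin 2) K) a b = 1 ∨
            (γ (Projectivization.mk K w hw) : Matrix (Fin 2) (Fin 2) K) a b = (w i)⁻¹ * w k ∨
            (γ (Projectivization.mk K w hw) : Matrix (Fin 2) (Fin 2) K) a b = -((w i)⁻¹ * w k)) ∧
          (∃ k : Fin 2, (((γ (Projectivization.mk K w hw))⁻¹ : GL (Fin 2) K) : Matrix (Fin 2) (Fin 2) K) a b = 0 ∨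
            (((γ (Projectivization.mk K w hw))⁻¹ : GL (Fin 2) K) : Matrix (Fin 2) (Fin 2) K) a b = 1 ∨
            (((γ (Projectivization.mk K w hw))⁻¹ : GL (Fin 2) K) : Matrix (Fin 2) (Fin 2) K) a b = (w i)⁻¹ * w k ∨
            (((γ (Projectivization.mk K w hw))⁻¹ : GL (Fin 2) K) : Matrix (Fin 2) (Fin 2) K) a b = -((w i)⁻¹ * w k)) := by
  classical
  -- the section on representatives: `σ v := (0 1; 1 v₁/v₀)` if `v₀ ≠ 0`, else `1`
  let σ : (Fin 2 → K) → GL (Fin 2) K := fun v =>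
    if v 0 ≠ 0 then ⟨!![(0 : K), 1; 1, (v 0)⁻¹ * v 1], !![-((v 0)⁻¹ * v 1), 1; 1, 0], swapT_mul_inv _, inv_mul_swapT _⟩ else 1
  -- `σ` is constant on lines
  have hσ_smul : ∀ (v : Fin 2 → K) (c : K), c ≠ 0 → σ (c • v) = σ v := by
    intro v c hc
    by_cases h0 : v 0 ≠ 0
    · have hc0 : (c • v) 0 ≠ 0 := by simpa [Pi.smul_apply, smul_eq_mul] using mul_ne_zero hc h0
      simp only [σ, if_pos h0, if_pos hc0]
      congr 1 <;> ext a b <;> fin_cases a <;> fin_cases b <;>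
        simp [Pi.smul_apply, smul_eq_mul, mul_assoc, inv_mul_cancel_left₀ hc]
    · have h0' : v 0 = 0 := not_not.1 h0
      have hc0 : ¬ (c • v) 0 ≠ 0 := by simp [Pi.smul_apply, smul_eq_mul, h0']
      simp only [σ, if_neg h0, if_neg hc0]
  -- the normalised second row
  have hrow : ∀ (v : Fin 2 → K), v ≠ 0 → ∃ i : Fin 2, v i ≠ 0 ∧ (σ v : Matrix (Fin 2) (Fin 2) K) 1 = (v i)⁻¹ • v := by
    intro v hv
    by_cases h0 : v 0 ≠ 0
    · refine ⟨0, h0, ?_⟩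
      simp only [σ, if_pos h0]
      ext b
      fin_cases b <;> simp [inv_mul_cancel₀ h0]
    · push Not at h0
      have h1 : v 1 ≠ 0 := by
        intro h1
        apply hv
        ext b
        fin_cases b <;> simp [h0, h1]
      refine ⟨1, h1, ?_⟩
      simp only [σ, if_neg (not_not.2 h0)]
      ext b
      fin_cases b <;> simp [h0, inv_mul_cancel₀ h1]
  refine ⟨fun p => σ p.rep, fun p => ?_, fun w hw => ?_⟩
  · -- `[row₁ (σ p.rep)] = [p.rep / (p.rep)_i] = [p.rep] = p`
    obtain ⟨i, hi, hrowi⟩ := hrow p.rep p.rep_nonzero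
    conv_rhs => rw [← p.mk_rep]
    rw [Projectivization.mk_eq_mk_iff']
    exact ⟨(p.rep i)⁻¹, hrowi.symm⟩
  · -- transport from `p.rep` to the given representative `w = a • p.rep`
    obtain ⟨a, ha⟩ := Projectivization.exists_smul_eq_mk_rep K w hw
    have hσw : (fun p : Projectivization K (Fin 2 → K) => σ p.rep) (Projectivization.mk K w hw) = σ w := by
      show σ (Projectivization.mk K w hw).rep = σ w
      rw [← ha, Units.smul_def, hσ_smul w (a : K) a.ne_zero]
    rw [hσw]
    by_cases h0 : w 0 ≠ 0
    · -- `γ = (0 1; 1 w₁/w₀)`, `γ⁻¹ = (−w₁/w₀ 1; 1 0)`, `i = 0`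
      refine ⟨0, h0, ?_, fun a' b => ⟨?_, ?_⟩⟩
      · simp only [σ, if_pos h0]
        ext b
        fin_cases b <;> simp [inv_mul_cancel₀ h0]
      · simp only [σ, if_pos h0]
        rcases swapT_apply_mem ((w 0)⁻¹ * w 1) a' b with h | h | h
        · exact ⟨0, Or.inl h⟩
        · exact ⟨0, Or.inr (Or.inl h)⟩
        · exact ⟨1, Or.inr (Or.inr (Or.inl h))⟩
      · simp only [σ, if_pos h0, Units.inv_mk]
        rcases swapTinv_apply_mem ((w 0)⁻¹ * w 1) a' b with h | h | h
        · exact ⟨0, Or.inl h⟩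
        · exact ⟨0, Or.inr (Or.inl h)⟩
        · exact ⟨1, Or.inr (Or.inr (Or.inr h))⟩
    · -- `w₀ = 0`, `w₁ ≠ 0`: `γ = γ⁻¹ = 1`, `i = 1`
      push Not at h0
      have h1 : w 1 ≠ 0 := by
        intro h1
        apply hw
        ext b
        fin_cases b <;> simp [h0, h1]
      refine ⟨1, h1, ?_, fun a' b => ⟨⟨1, ?_⟩, ⟨1, ?_⟩⟩⟩
      · simp only [σ, if_neg (not_not.2 h0), Units.val_one]
        ext b
        fin_cases b <;> simp [h0, inv_mul_cancel₀ h1, Matrix.one_apply]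
      all_goals simp only [σ, if_neg (not_not.2 h0), inv_one, Units.val_one]
      all_goals
        rcases eq_or_ne a' b with hab | hab
        · subst hab; exact Or.inr (Or.inl (Matrix.one_apply_eq a'))
        · exact Or.inl (Matrix.one_apply_ne hab)

end Summit.HodgeConjecture.HodgeConjecture.Cruxes.HLiu418.K2LiuRankOneRowSection

end
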